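import Summits.NavierStokesRegularity.NavierStokesRegularity.Theorems.SymmetryModuliCountFarPastLedger
import Summits.NavierStokesRegularity.NavierStokesRegularity.Theorems.SymmetryModuliCountAxisymEndLiouvilleOfFarPastLedgerCubic
import Literature.Analysis.FluidPDE.TypeIAncientMild
import Literature.Analysis.FluidPDE.SelfSimilar

/-!
# Crux `AdaptedFrequencyConverges` (stmt-NavierStokesRegularity-10493), line `birkhoff-recurrent-hull`:
# `L³_loc` scaling-recurrence from `C⁰` recurrence on cylinders (helper of `stub_recurrentPinchedBridge`)

Helper file (theorems only). For a Type-I ancient mild field `W ∈ A_{C₀}`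
(`IsTypeIAncientMild C₀ W`) which is uniformly recurrent under the parabolic scalings
`W ↦ nsRescale l W` in `C⁰` on the cylinders `{−R ≤ t ≤ −R⁻¹, ‖x‖ ≤ R}` (every multiplicative
window of scales `[a, L a]` contains a return), the recurrence holds in the form consumed by the
item `RecurrentProfiles.RecurrentLiouville` (stmt-1589): in `L³(K₁)` for every compact
`K₁ ⊆ {t ≤ 0} × ℝ³`, along additive windows `σ = log l ∈ [a, a + log L]`
(`l3Recurrence_of_supRecurrence`, registered).

Proof: split `K₁` at `t = −δ`. Below, the sup bound on a cylinder containing `K₁ ∩ {t ≤ −δ}`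
(`eLpNorm_le_of_ae_bound`). On the thin final slab `(−δ, 0) × B_R` BOTH `W` and
`nsRescale l W ∈ A_{C₀}` (`isTypeIAncientMild_nsRescale`) obey the CLASS-UNIFORM cubic bound
`∫∫ ‖u‖³ ≤ 2 C₀ K_A R √δ` — rate `‖u‖ ≤ C₀/√(−t)` times the far-past ledger
`∫_{B_R}‖u(t)‖² ≤ K_A R` (PROVED crux `FarPastLedger`, stmt-14060, `FarPastLedger_proof`), and
`∫_{−δ}^{0} (−τ)^{−1/2} dτ ≤ 2√δ` (`lintegral_thinSlab_le`, adapted from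
`lintegral_parabolicCylinder_le`); the slice `t = 0` is null.

References: H. Furstenberg, *Recurrence in ergodic theory and combinatorial number theory* (1981),
Def. 1.8 [Furstenberg1981]; D. Albritton, T. Barker, arXiv:1811.00502 §3 [AlbrittonBarker2019].
-/

noncomputable section

open MeasureTheory Set Filter Metric Topology Function
open Literature.Analysis.FluidPDE
open scoped ENNReal NNReal

-- the summit and its single problem share the name (D-0017 nested layout)
set_option linter.dupNamespace false

namespace Summit.NavierStokesRegularity.NavierStokesRegularity.Theorems.AdaptedFrequencyConverges.BirkhoffRecurrentHull

open Summit.NavierStokesRegularity.NavierStokesRegularity.Theorems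
open Summit.NavierStokesRegularity.NavierStokesRegularity.Theorems.AxisymEndLiouvilleOfFarPastLedger
  (setLIntegral_enorm_pow_three_le integral_inv_sqrt_neg_le)

/-! ### The thin final slab: a class-uniform cubic bound -/

/-- **The cubic bound on a thin final slab.** For `u ∈ A_C` with the velocity ledger
`∫_{B_R(x₀)} ‖u(t)‖² ≤ K R`, every `δ > 0` and `R > 0`:
`∫_{(−δ,0) × B_R(0)} ‖u‖³ ≤ 2 C K R √δ` (Tonelli, the slice bound
`∫_{B_R} ‖u(t)‖³ ≤ (C/√(−t)) K R`, and `∫_{−δ}^{0} (−τ)^{−1/2} dτ ≤ 2√δ`); adapted from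
`lintegral_parabolicCylinder_le`. [folklore] -/
theorem lintegral_thinSlab_le {C K : ℝ}
    {u : ℝ → EuclideanSpace ℝ (Fin 3) → EuclideanSpace ℝ (Fin 3)} (hu : IsTypeIAncientMild C u)
    (hK : ∀ t < 0, ∀ (x₀ : EuclideanSpace ℝ (Fin 3)) (R : ℝ), 0 < R →
      ∫ x in ball x₀ R, ‖u t x‖ ^ 2 ≤ K * R)
    {δ : ℝ} (hδ : 0 < δ) {R : ℝ} (hR : 0 < R) :
    ∫⁻ z in Ioo (-δ) 0 ×ˢ ball (0 : EuclideanSpace ℝ (Fin 3)) R, ‖u z.1 z.2‖ₑ ^ (3 : ℕ) ≤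
      ENNReal.ofReal (2 * C * K * R * Real.sqrt δ) := by
  -- adapted from `lintegral_parabolicCylinder_le` (Theorems/SymmetryModuliCountAxisymEndLiouvilleOfFarPastLedgerCubic)
  have hC : 0 ≤ C := hu.nonneg
  have hK0 : 0 ≤ K := by
    have h := hK (-1) (by norm_num) 0 1 one_pos
    have h0 : 0 ≤ ∫ x in ball (0 : EuclideanSpace ℝ (Fin 3)) 1, ‖u (-1) x‖ ^ 2 :=
      integral_nonneg fun x => sq_nonneg _
    linarith
  set I : Set ℝ := Ioo (-δ) 0 with hI
  set B : Set (EuclideanSpace ℝ (Fin 3)) := ball 0 R with hB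
  -- Tonelli (inequality form)
  have hprod : ∫⁻ z in I ×ˢ B, ‖u z.1 z.2‖ₑ ^ (3 : ℕ) ≤ ∫⁻ τ in I, ∫⁻ x in B, ‖u τ x‖ₑ ^ (3 : ℕ) := by
    have e : (volume : Measure (ℝ × EuclideanSpace ℝ (Fin 3))).restrict (I ×ˢ B) =
        ((volume : Measure ℝ).restrict I).prod
          ((volume : Measure (EuclideanSpace ℝ (Fin 3))).restrict B) := by
      rw [Measure.volume_eq_prod, Measure.prod_restrict]
    rw [e]
    exact lintegral_prod_le _
  refine hprod.trans ?_
  -- the slice bound, for `τ ∈ I ⊆ (-∞, 0)`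
  have hslice : ∀ τ ∈ I, ∫⁻ x in B, ‖u τ x‖ₑ ^ (3 : ℕ) ≤
      ENNReal.ofReal (C * K * R * (Real.sqrt (-τ))⁻¹) := by
    intro τ hτ
    refine (setLIntegral_enorm_pow_three_le hu hK hτ.2 0 hR).trans (le_of_eq ?_)
    congr 1
    rw [div_eq_mul_inv]
    ring
  have hmono : ∫⁻ τ in I, ∫⁻ x in B, ‖u τ x‖ₑ ^ (3 : ℕ) ≤
      ∫⁻ τ in I, ENNReal.ofReal (C * K * R * (Real.sqrt (-τ))⁻¹) :=
    setLIntegral_mono' measurableSet_Ioo fun τ hτ => hslice τ hτ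
  refine hmono.trans ?_
  -- integrate the majorant in time
  have hab : -δ ≤ (0 : ℝ) := by linarith
  have hii : IntervalIntegrable (fun τ : ℝ => (Real.sqrt (-τ))⁻¹) volume (-δ) 0 := by
    have h1 : IntervalIntegrable (fun σ : ℝ => σ ^ (-(1 / 2) : ℝ)) volume (-(-δ)) (-0) :=
      intervalIntegral.intervalIntegrable_rpow' (by norm_num)
    have h3 : IntervalIntegrable (fun τ : ℝ => (-τ) ^ (-(1 / 2) : ℝ)) volume (-δ) 0 := by
      have h2 := (IntervalIntegrable.iff_comp_neg (f := fun σ : ℝ => σ ^ (-(1 / 2) : ℝ))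
        (a := -(-δ)) (b := -0)).mp h1
      simpa only [neg_neg, neg_zero] using h2
    refine h3.congr fun τ hτ => ?_
    have hτ0 : 0 ≤ -τ := by
      rw [uIoc_of_le hab] at hτ
      linarith [hτ.2]
    rw [Real.sqrt_eq_rpow, Real.rpow_neg hτ0]
  have hint : IntegrableOn (fun τ : ℝ => (Real.sqrt (-τ))⁻¹) (Ioc (-δ) 0) volume :=
    (intervalIntegrable_iff_integrableOn_Ioc_of_le hab).1 hii
  have hintI : IntegrableOn (fun τ : ℝ => (Real.sqrt (-τ))⁻¹) I volume :=
    hint.mono_set Ioo_subset_Ioc_self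
  calc ∫⁻ τ in I, ENNReal.ofReal (C * K * R * (Real.sqrt (-τ))⁻¹)
      = ∫⁻ τ in I, ENNReal.ofReal (C * K * R) * ENNReal.ofReal ((Real.sqrt (-τ))⁻¹) := by
        refine lintegral_congr fun τ => ?_
        rw [← ENNReal.ofReal_mul (by positivity)]
    _ = ENNReal.ofReal (C * K * R) * ∫⁻ τ in I, ENNReal.ofReal ((Real.sqrt (-τ))⁻¹) := by
        rw [lintegral_const_mul' _ _ ENNReal.ofReal_ne_top]
    _ = ENNReal.ofReal (C * K * R) * ENNReal.ofReal (∫ τ in I, (Real.sqrt (-τ))⁻¹) := by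
        rw [ofReal_integral_eq_lintegral_ofReal hintI
          (ae_of_all _ fun τ => inv_nonneg.2 (Real.sqrt_nonneg _))]
    _ ≤ ENNReal.ofReal (C * K * R) * ENNReal.ofReal (2 * Real.sqrt δ) := by
        gcongr
        calc ∫ τ in I, (Real.sqrt (-τ))⁻¹
            = ∫ τ in Ioc (-δ) 0, (Real.sqrt (-τ))⁻¹ := setIntegral_congr_set Ioo_ae_eq_Ioc
          _ = ∫ τ in (-δ)..0, (Real.sqrt (-τ))⁻¹ := (intervalIntegral.integral_of_le hab).symm
          _ ≤ 2 * Real.sqrt (0 - (-δ)) := integral_inv_sqrt_neg_le hab le_rfl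
          _ = 2 * Real.sqrt δ := by rw [sub_neg_eq_add, zero_add]
    _ = ENNReal.ofReal (2 * C * K * R * Real.sqrt δ) := by
        rw [← ENNReal.ofReal_mul (by positivity)]
        congr 1
        ring

/-- **The `L³` norm on a thin final slab**, class-uniformly:
`‖u‖_{L³((−δ,0) × B_R)} ≤ (2 C K R √δ)^{1/3}` for `u ∈ A_C` with the velocity ledger `K`.
[folklore] -/
theorem eLpNorm_three_thinSlab_le {C K : ℝ}
    {u : ℝ → EuclideanSpace ℝ (Fin 3) → EuclideanSpace ℝ (Fin 3)} (hu : IsTypeIAncientMild C u)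
    (hK : ∀ t < 0, ∀ (x₀ : EuclideanSpace ℝ (Fin 3)) (R : ℝ), 0 < R →
      ∫ x in ball x₀ R, ‖u t x‖ ^ 2 ≤ K * R)
    {δ : ℝ} (hδ : 0 < δ) {R : ℝ} (hR : 0 < R) :
    eLpNorm (fun z : ℝ × EuclideanSpace ℝ (Fin 3) => u z.1 z.2) 3
        (volume.restrict (Ioo (-δ) 0 ×ˢ ball (0 : EuclideanSpace ℝ (Fin 3)) R)) ≤
      ENNReal.ofReal ((2 * C * K * R * Real.sqrt δ) ^ (1 / 3 : ℝ)) := by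
  have hC : 0 ≤ C := hu.nonneg
  have hK0 : 0 ≤ K := by
    have h := hK (-1) (by norm_num) 0 1 one_pos
    have h0 : 0 ≤ ∫ x in ball (0 : EuclideanSpace ℝ (Fin 3)) 1, ‖u (-1) x‖ ^ 2 :=
      integral_nonneg fun x => sq_nonneg _
    linarith
  have hB0 : 0 ≤ 2 * C * K * R * Real.sqrt δ := by positivity
  rw [eLpNorm_eq_lintegral_rpow_enorm_toReal (by norm_num) (by norm_num), ENNReal.toReal_ofNat,
    ← ENNReal.ofReal_rpow_of_nonneg hB0 (by norm_num)]
  refine ENNReal.rpow_le_rpow ?_ (by norm_num)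
  have e : ∀ x : ℝ≥0∞, x ^ (3 : ℝ) = x ^ (3 : ℕ) := fun x => by
    rw [← ENNReal.rpow_natCast]
    norm_num
  simp only [e]
  exact lintegral_thinSlab_le hu hK hδ hR

/-! ### Measure-theoretic tools -/

/-- `‖f‖_{L³(μ + ν)} ≤ ‖f‖_{L³(μ)} + ‖f‖_{L³(ν)}` (`(a + b)^{1/3} ≤ a^{1/3} + b^{1/3}`). [folklore] -/
theorem eLpNorm_three_add_measure_le {α : Type*} [MeasurableSpace α] {F : Type*}
    [NormedAddCommGroup F] (f : α → F) (μ ν : Measure α) :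
    eLpNorm f 3 (μ + ν) ≤ eLpNorm f 3 μ + eLpNorm f 3 ν := by
  simp only [eLpNorm_eq_lintegral_rpow_enorm_toReal (by norm_num : (3 : ℝ≥0∞) ≠ 0)
    (by norm_num : (3 : ℝ≥0∞) ≠ ⊤), lintegral_add_measure]
  exact ENNReal.rpow_add_le_add_rpow _ _ (by positivity) (by norm_num)

/-- A compact subset of `{t ≤ 0} × ℝ³` lies in a box `[−R₀, 0] × B̄_{R₀}(0)`, `R₀ > 0`. [folklore] -/
theorem exists_box_of_isCompact {K₁ : Set (ℝ × EuclideanSpace ℝ (Fin 3))} (hK₁ : IsCompact K₁)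
    (hsub : K₁ ⊆ Iic (0 : ℝ) ×ˢ (univ : Set (EuclideanSpace ℝ (Fin 3)))) :
    ∃ R₀ : ℝ, 0 < R₀ ∧ ∀ z ∈ K₁, -R₀ ≤ z.1 ∧ z.1 ≤ 0 ∧ ‖z.2‖ ≤ R₀ := by
  obtain ⟨R', hR'⟩ := hK₁.isBounded.subset_closedBall (0 : ℝ × EuclideanSpace ℝ (Fin 3))
  refine ⟨max R' 1, by positivity, fun z hz => ?_⟩
  have h1 : ‖z‖ ≤ R' := mem_closedBall_zero_iff.1 (hR' hz)
  have h2 : |z.1| ≤ ‖z‖ := by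
    have := norm_fst_le z
    rwa [Real.norm_eq_abs] at this
  have h3 : ‖z.2‖ ≤ ‖z‖ := norm_snd_le z
  refine ⟨?_, (hsub hz).1, ?_⟩
  · have := neg_abs_le z.1
    linarith [le_max_left R' 1]
  · linarith [le_max_left R' 1]

/-! ### (iv) `L³_loc` scaling-recurrence from the `C⁰` recurrence on cylinders -/

/-- **`L³_loc({t ≤ 0} × ℝ³)` scaling-recurrence of a `C⁰`-recurrent element of `A_{C₀}`.** If
`W ∈ A_{C₀}` returns, in every multiplicative window of scales `[a, L a]`, `ε`-close to itself in
`C⁰` on the cylinder `{−R ≤ t ≤ −R⁻¹, ‖x‖ ≤ R}` under `W ↦ nsRescale l W`, then for every compact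
`K₁ ⊆ {t ≤ 0} × ℝ³` and `ε > 0` every additive window `[a, a + log L]` contains `σ` with
`‖nsRescale (e^σ) W − W‖_{L³(K₁)} ≤ ε`: split `K₁` at `t = −δ`; below, the sup bound on a cylinder
containing `K₁ ∩ {t ≤ −δ}`; on the thin final slab both `W` and `nsRescale l W ∈ A_{C₀}`
(`isTypeIAncientMild_nsRescale`) obey `‖u‖_{L³((−δ,0)×B_R)} ≤ (2C₀K_AR√δ)^{1/3}`
(`eLpNorm_three_thinSlab_le`, ledger `FarPastLedger_proof`); the slice `t = 0` is null.
[cite: Furstenberg1981, Def. 1.8; AlbrittonBarker2019, §3] -/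
theorem l3Recurrence_of_supRecurrence :
    ∀ (C₀ : ℝ) (W : ℝ → EuclideanSpace ℝ (Fin 3) → EuclideanSpace ℝ (Fin 3)),
    Literature.Analysis.FluidPDE.IsTypeIAncientMild C₀ W →
    (∀ ε : ℝ, 0 < ε → ∀ R : ℝ, 1 < R → ∃ L : ℝ, 1 < L ∧ ∀ a : ℝ, 0 < a → ∃ l : ℝ,
      a ≤ l ∧ l ≤ L * a ∧ ∀ (t : ℝ) (x : EuclideanSpace ℝ (Fin 3)), -R ≤ t → t ≤ -R⁻¹ → ‖x‖ ≤ R →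
        ‖Literature.Analysis.FluidPDE.nsRescale l W t x - W t x‖ ≤ ε) →
    ∀ ε : ℝ, 0 < ε → ∀ K₁ : Set (ℝ × EuclideanSpace ℝ (Fin 3)), IsCompact K₁ →
      K₁ ⊆ Set.Iic (0 : ℝ) ×ˢ Set.univ →
      ∃ L : ℝ, 0 < L ∧ ∀ a : ℝ, ∃ σ ∈ Set.Icc a (a + L),
        MeasureTheory.eLpNorm (fun z : ℝ × EuclideanSpace ℝ (Fin 3) =>
          Literature.Analysis.FluidPDE.nsRescale (Real.exp σ) W z.1 z.2 - W z.1 z.2) 3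
          (MeasureTheory.volume.restrict K₁) ≤ ENNReal.ofReal ε := by
  intro C₀ W hW hrec ε hε K₁ hK₁ hK₁sub
  obtain ⟨KA, hKA⟩ := FarPastLedger_proof C₀
  have hC₀ : 0 ≤ C₀ := hW.nonneg
  have hKA0 : 0 ≤ KA := by
    have h := hKA W hW (-1) (by norm_num) 0 1 one_pos
    have h0 : 0 ≤ ∫ x in ball (0 : EuclideanSpace ℝ (Fin 3)) 1, ‖W (-1) x‖ ^ 2 :=
      integral_nonneg fun x => sq_nonneg _
    linarith
  obtain ⟨R₀, hR₀, hbox⟩ := exists_box_of_isCompact hK₁ hK₁sub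
  -- ### the thin final slab `(−δ, 0) × B_{R₀+1}`
  set η : ℝ := (ε / 4) ^ 3 with hη
  have hη0 : 0 < η := by positivity
  set M : ℝ := 2 * C₀ * KA * (R₀ + 1) + 1 with hM
  have hM0 : 0 < M := by positivity
  set δ : ℝ := (η / M) ^ 2 with hδdef
  have hδ : 0 < δ := by positivity
  have hsqrtδ : Real.sqrt δ = η / M := by rw [hδdef, Real.sqrt_sq (by positivity)]
  have hthin : 2 * C₀ * KA * (R₀ + 1) * Real.sqrt δ ≤ η := by
    rw [hsqrtδ]
    have h1 : 2 * C₀ * KA * (R₀ + 1) ≤ M := by rw [hM]; linarith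
    calc 2 * C₀ * KA * (R₀ + 1) * (η / M) ≤ M * (η / M) :=
          mul_le_mul_of_nonneg_right h1 (by positivity)
      _ = η := by field_simp
  -- ### the cylinder `{−R ≤ t ≤ −R⁻¹, ‖x‖ ≤ R}` of the `C⁰` recurrence
  set R : ℝ := max R₀ δ⁻¹ + 1 with hRdef
  have hδi : 0 < δ⁻¹ := inv_pos.2 hδ
  have hR1 : 1 < R := by
    have : δ⁻¹ ≤ max R₀ δ⁻¹ := le_max_right _ _
    rw [hRdef]; linarith
  have hR0 : 0 < R := by linarith
  have hRR₀ : R₀ ≤ R := by rw [hRdef]; linarith [le_max_left R₀ δ⁻¹]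
  have hRδ : R⁻¹ ≤ δ := by
    have h1 : δ⁻¹ < R := by rw [hRdef]; linarith [le_max_right R₀ δ⁻¹]
    have h2 : R⁻¹ < δ⁻¹⁻¹ := (inv_lt_inv₀ hR0 hδi).2 h1
    rw [inv_inv] at h2
    exact h2.le
  -- ### the sup tolerance `ε'` with `|K₁|^{1/3} ε' ≤ ε/2`
  have hV : volume K₁ < ⊤ := hK₁.measure_lt_top
  set T : ℝ := ((volume K₁) ^ (3 : ℝ)⁻¹).toReal with hTdef
  have hT0 : 0 ≤ T := ENNReal.toReal_nonneg
  set ε' : ℝ := ε / 2 / (T + 1) with hε'def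
  have hε' : 0 < ε' := by positivity
  obtain ⟨L, hL1, hL⟩ := hrec ε' hε' R hR1
  refine ⟨Real.log L, Real.log_pos hL1, fun a => ?_⟩
  obtain ⟨l, hal, hlL, hl⟩ := hL (Real.exp a) (Real.exp_pos a)
  have hl0 : 0 < l := (Real.exp_pos a).trans_le hal
  refine ⟨Real.log l, ⟨?_, ?_⟩, ?_⟩
  · calc a = Real.log (Real.exp a) := (Real.log_exp a).symm
      _ ≤ Real.log l := Real.log_le_log (Real.exp_pos a) hal
  · calc Real.log l ≤ Real.log (L * Real.exp a) := Real.log_le_log hl0 hlL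
      _ = a + Real.log L := by
          rw [Real.log_mul (by linarith) (Real.exp_pos a).ne', Real.log_exp]; ring
  rw [Real.exp_log hl0]
  -- ### the estimate
  set f : ℝ × EuclideanSpace ℝ (Fin 3) → EuclideanSpace ℝ (Fin 3) :=
    fun z => nsRescale l W z.1 z.2 - W z.1 z.2 with hf
  set S₁ : Set (ℝ × EuclideanSpace ℝ (Fin 3)) := K₁ ∩ (Iic (-δ) ×ˢ univ) with hS₁
  set S₂ : Set (ℝ × EuclideanSpace ℝ (Fin 3)) :=
    Ioo (-δ) 0 ×ˢ ball (0 : EuclideanSpace ℝ (Fin 3)) (R₀ + 1) with hS₂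
  set N : Set (ℝ × EuclideanSpace ℝ (Fin 3)) :=
    ({0} : Set ℝ) ×ˢ (univ : Set (EuclideanSpace ℝ (Fin 3))) with hN
  have hS₁m : MeasurableSet S₁ :=
    hK₁.isClosed.measurableSet.inter (measurableSet_Iic.prod MeasurableSet.univ)
  have hS₂m : MeasurableSet S₂ := measurableSet_Ioo.prod measurableSet_ball
  have hNnull : volume N = 0 := by
    rw [hN, Measure.volume_eq_prod, Measure.prod_prod, Real.volume_singleton, zero_mul]
  have hcover : K₁ ⊆ S₁ ∪ S₂ ∪ N := by
    intro z hz
    obtain ⟨h1, h2, h3⟩ := hbox z hz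
    by_cases hzδ : z.1 ≤ -δ
    · exact Or.inl (Or.inl ⟨hz, ⟨hzδ, mem_univ _⟩⟩)
    · rcases lt_or_eq_of_le h2 with h2' | h2'
      · refine Or.inl (Or.inr ⟨⟨lt_of_not_ge hzδ, h2'⟩, ?_⟩)
        rw [mem_ball_zero_iff]
        linarith
      · exact Or.inr ⟨h2', mem_univ _⟩
  have hae : (S₁ ∪ S₂ ∪ N : Set (ℝ × EuclideanSpace ℝ (Fin 3))) =ᵐ[volume]
      (S₁ ∪ S₂ : Set (ℝ × EuclideanSpace ℝ (Fin 3))) :=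
    union_ae_eq_left_of_ae_eq_empty (ae_eq_empty.2 hNnull)
  have hstep1 : eLpNorm f 3 (volume.restrict K₁) ≤
      eLpNorm f 3 (volume.restrict S₁) + eLpNorm f 3 (volume.restrict S₂) :=
    calc eLpNorm f 3 (volume.restrict K₁) ≤ eLpNorm f 3 (volume.restrict (S₁ ∪ S₂ ∪ N)) :=
          eLpNorm_mono_measure f (Measure.restrict_mono hcover le_rfl)
      _ = eLpNorm f 3 (volume.restrict (S₁ ∪ S₂)) := by rw [Measure.restrict_congr_set hae]
      _ ≤ eLpNorm f 3 (volume.restrict S₁ + volume.restrict S₂) :=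
          eLpNorm_mono_measure f (Measure.restrict_union_le S₁ S₂)
      _ ≤ eLpNorm f 3 (volume.restrict S₁) + eLpNorm f 3 (volume.restrict S₂) :=
          eLpNorm_three_add_measure_le f _ _
  -- the sup part
  have hsup : eLpNorm f 3 (volume.restrict S₁) ≤ ENNReal.ofReal (ε / 2) := by
    have hbd : ∀ᵐ z ∂(volume.restrict S₁), ‖f z‖ ≤ ε' := by
      refine (ae_restrict_mem hS₁m).mono fun z hz => ?_
      obtain ⟨h1, h2, h3⟩ := hbox z hz.1
      have hz1 : z.1 ≤ -δ := hz.2.1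
      exact hl z.1 z.2 (by linarith) (by linarith) (h3.trans hRR₀)
    have key := eLpNorm_le_of_ae_bound (p := 3) hbd
    rw [Measure.restrict_apply_univ] at key
    refine key.trans ?_
    have hmono : volume S₁ ^ ((3 : ℝ≥0∞).toReal)⁻¹ ≤ volume K₁ ^ (3 : ℝ)⁻¹ := by
      rw [ENNReal.toReal_ofNat]
      exact ENNReal.rpow_le_rpow (measure_mono inter_subset_left) (by norm_num)
    have hfin : volume K₁ ^ (3 : ℝ)⁻¹ ≠ ⊤ := ENNReal.rpow_ne_top_of_nonneg (by norm_num) hV.ne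
    have hTε : T * ε' ≤ ε / 2 := by
      rw [hε'def]
      have e : T * (ε / 2 / (T + 1)) = ε / 2 * (T / (T + 1)) := by ring
      rw [e]
      have hT1 : T / (T + 1) ≤ 1 := (div_le_one (by positivity)).2 (by linarith)
      have hT2 : 0 ≤ T / (T + 1) := by positivity
      nlinarith
    calc volume S₁ ^ ((3 : ℝ≥0∞).toReal)⁻¹ * ENNReal.ofReal ε'
        ≤ volume K₁ ^ (3 : ℝ)⁻¹ * ENNReal.ofReal ε' := mul_le_mul_of_nonneg_right hmono (by positivity)
      _ = ENNReal.ofReal (T * ε') := by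
          rw [ENNReal.ofReal_mul hT0, hTdef, ENNReal.ofReal_toReal hfin]
      _ ≤ ENNReal.ofReal (ε / 2) := ENNReal.ofReal_le_ofReal hTε
  -- the thin part
  have hS₂sub : S₂ ⊆ Iio (0 : ℝ) ×ˢ (univ : Set (EuclideanSpace ℝ (Fin 3))) :=
    prod_mono Ioo_subset_Iio_self (subset_univ _)
  have hthinU : ∀ u : ℝ → EuclideanSpace ℝ (Fin 3) → EuclideanSpace ℝ (Fin 3),
      IsTypeIAncientMild C₀ u →
      eLpNorm (fun z : ℝ × EuclideanSpace ℝ (Fin 3) => u z.1 z.2) 3 (volume.restrict S₂) ≤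
        ENNReal.ofReal (ε / 4) := by
    intro u hu
    refine (eLpNorm_three_thinSlab_le hu (hKA u hu) hδ (by linarith : 0 < R₀ + 1)).trans ?_
    refine ENNReal.ofReal_le_ofReal ?_
    have e : η ^ (1 / 3 : ℝ) = ε / 4 := by
      rw [hη, show (1 / 3 : ℝ) = ((3 : ℕ) : ℝ)⁻¹ by norm_num]
      exact Real.pow_rpow_inv_natCast (by positivity) three_ne_zero
    calc (2 * C₀ * KA * (R₀ + 1) * Real.sqrt δ) ^ (1 / 3 : ℝ) ≤ η ^ (1 / 3 : ℝ) :=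
          Real.rpow_le_rpow (by positivity) hthin (by norm_num)
      _ = ε / 4 := e
  have hm : ∀ u : ℝ → EuclideanSpace ℝ (Fin 3) → EuclideanSpace ℝ (Fin 3),
      IsTypeIAncientMild C₀ u →
      AEStronglyMeasurable (fun z : ℝ × EuclideanSpace ℝ (Fin 3) => u z.1 z.2)
        (volume.restrict S₂) :=
    fun u hu => (hu.continuousOn_uncurry.mono hS₂sub).aestronglyMeasurable hS₂m
  have hthin2 : eLpNorm f 3 (volume.restrict S₂) ≤
      ENNReal.ofReal (ε / 4) + ENNReal.ofReal (ε / 4) := by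
    have hWl : IsTypeIAncientMild C₀ (nsRescale l W) := isTypeIAncientMild_nsRescale hW hl0
    calc eLpNorm f 3 (volume.restrict S₂)
        ≤ eLpNorm (fun z : ℝ × EuclideanSpace ℝ (Fin 3) => nsRescale l W z.1 z.2) 3
            (volume.restrict S₂) +
          eLpNorm (fun z : ℝ × EuclideanSpace ℝ (Fin 3) => W z.1 z.2) 3 (volume.restrict S₂) :=
          eLpNorm_sub_le (hm _ hWl) (hm _ hW) (by norm_num)
      _ ≤ ENNReal.ofReal (ε / 4) + ENNReal.ofReal (ε / 4) := add_le_add (hthinU _ hWl) (hthinU _ hW)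
  -- assemble
  calc eLpNorm f 3 (volume.restrict K₁)
      ≤ ENNReal.ofReal (ε / 2) + (ENNReal.ofReal (ε / 4) + ENNReal.ofReal (ε / 4)) :=
        hstep1.trans (add_le_add hsup hthin2)
    _ = ENNReal.ofReal ε := by
        rw [← ENNReal.ofReal_add (by positivity) (by positivity),
          ← ENNReal.ofReal_add (by positivity) (by positivity)]
        congr 1
        ring

end Summit.NavierStokesRegularity.NavierStokesRegularity.Theorems.AdaptedFrequencyConverges.BirkhoffRecurrentHull

end
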